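import Summits.ValiantsHypothesis.ValiantsHypothesis.Theorems.BarrierLeverDescentCertificateSufficesBlocks
import Summits.ValiantsHypothesis.ValiantsHypothesis.Theorems.BarrierLeverTropicalDetCertificateSuffices

/-!
# Route BarrierLever — LP-DUAL CERTIFICATE FORMAT for tropical-determinant certificates
# (UT-D, item stmt-ValiantsHypothesis-19316; TT instances via item 19315)

Helper file (`--supports stmt-ValiantsHypothesis-19316`; cell valiant-natproofs, rung V4, 𝒟-side;
prover seat val-np-p1; requested in the planner memo `UTD-memo-g9.md` §5 item 3 «finite
instances … use the LP-dual format … a prover-side lemma `uniqueAssignment_of_dualCertificate`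
plus 19315 turns each census line into a theorem»). Closes NO item.

**The problem.** A UT-D certificate for a layout `u, w : Fin r → Finset (Fin h)` is a weight `D`
on literal pairs and an outer assignment `π₀` that is the UNIQUE minimiser of
`σ ↦ Σ_j ω (σ j) j`, where `ω i j = min_τ Σ_a D (ρ_{u i} a) (κ_{w j} (τ a))` is the tropical
determinant of the block `(i, j)`. Checking this naively enumerates `Perm (Fin h)` and
`Perm (Fin r)`.

**The format (all checks are finitely many integer (in)equalities).**
* INNER (`inf'_eq_of_innerDuals`): for a block with entries `M a b`, an inner assignment `σ₀` and
  potentials `φ, ψ : Fin h → ℤ` with `φ a + ψ b ≤ M a b` everywhere and equality along `σ₀` prove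
  `min_τ Σ_a M a (τ a) = Σ_a M a (σ₀ a)` (weak LP duality for the assignment problem).
* OUTER (`sum_lt_sum_of_duals`): potentials `α, β : Fin r → ℤ` with `α i + β j ≤ ω i j`, equality
  on the pairs `(π₀ j, j)`, and a NUMBERING `t : Fin r → ℕ` of the columns such that every other
  tight pair `(π₀ j', j)`, `j' ≠ j`, has `t j' < t j`, prove that `π₀` is the UNIQUE optimal outer
  assignment: any optimal `σ` uses tight pairs only, so `j ↦ π₀⁻¹ (σ j)` strictly decreases `t` at
  each moved column, which forces it to be the identity (`eq_one_of_numbering`). (A bipartite graph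
  with a perfect matching has no other one iff the matching edges can be ordered so that all other
  edges go one way — the acyclicity of the exchange digraph.)
* ASSEMBLY (`tropicalDetCertificate_of_duals`): inner data for every block plus outer data give
  the conclusion of UT-D for `(u, w)` VERBATIM, hence (`transversalMinor_nonsingular_of_duals`,
  with item 19315 `…TropicalDet.tropicalDetCertificateSuffices`) the conclusion of TT
  (item 19152) for that layout: `∃ H, det (det H[ρ_{u i}, κ_{w j}])_{i,j} ≠ 0`.
The census scripts (`HOME/p1/g9-scripts/cert2.py`, Hungarian duals) can emit
`(D, ω, σ₀, φ, ψ, π₀, α, β, t)`; each emitted certificate is then discharged by `decide` /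
`norm_num` on concrete tables.

WHAT THIS IS NOT: a certificate FORMAT and its soundness only; no layout is certified here;
UT-D (19316), TT / TNS / item 19717, crux stmt-ValiantsHypothesis-14610 and `VP` versus `VNP` are
untouched.
-/

-- layout Summits/ValiantsHypothesis/ValiantsHypothesis forces the duplicated namespace component
set_option linter.dupNamespace false

namespace Summit.ValiantsHypothesis.ValiantsHypothesis.Theorems.BarrierLever.DualCert

open Finset
open Summit.ValiantsHypothesis.ValiantsHypothesis.Theorems.BarrierLever.Descent (rowL colL)

variable {h : ℕ}

/-! ## 1. Unique perfect matchings from a numbering -/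

/-- A permutation that strictly decreases a numbering at each moved point is the identity
(the smallest moved point would be mapped to a smaller moved point). -/
theorem eq_one_of_numbering {r : ℕ} (κ : Equiv.Perm (Fin r)) (t : Fin r → ℕ)
    (ht : ∀ j, κ j ≠ j → t (κ j) < t j) : κ = 1 := by
  by_contra hne
  set T := univ.filter (fun j => κ j ≠ j) with hT
  have hmemT : ∀ j, j ∈ T ↔ κ j ≠ j := fun j => by
    rw [hT, mem_filter]; simp only [mem_univ, true_and]
  have hTne : T.Nonempty := by
    by_contra hemp
    rw [Finset.not_nonempty_iff_eq_empty] at hemp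
    apply hne
    ext j
    by_contra hj
    have hjT : j ∈ T := (hmemT j).mpr (fun heq => hj (by rw [heq, Equiv.Perm.coe_one, id]))
    rw [hemp] at hjT
    exact Finset.notMem_empty j hjT
  obtain ⟨j₀, hj₀, hmin⟩ := Finset.exists_min_image T t hTne
  have hκ : κ j₀ ≠ j₀ := (hmemT j₀).mp hj₀
  have hκT : κ j₀ ∈ T := (hmemT _).mpr (fun heq => hκ (κ.injective heq))
  exact absurd (hmin _ hκT) (not_le.mpr (ht j₀ hκ))

/-! ## 2. The outer certificate: potentials + numbering ⇒ unique optimal assignment -/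

/-- **OUTER LP-DUAL CERTIFICATE.** Potentials `α, β` dominated by `ω` and tight along `π₀`, plus a
numbering `t` of the columns that strictly increases along every other tight pair `(π₀ j', j)`,
make `π₀` the UNIQUE minimiser of `σ ↦ Σ_j ω (σ j) j`. -/
theorem sum_lt_sum_of_duals {r : ℕ} (ω : Fin r → Fin r → ℕ) (π₀ : Equiv.Perm (Fin r))
    (α β : Fin r → ℤ) (t : Fin r → ℕ)
    (hle : ∀ i j, α i + β j ≤ (ω i j : ℤ))
    (heq : ∀ j, α (π₀ j) + β j = (ω (π₀ j) j : ℤ))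
    (hacyc : ∀ j j', j' ≠ j → α (π₀ j') + β j = (ω (π₀ j') j : ℤ) → t j' < t j)
    (σ : Equiv.Perm (Fin r)) (hσ : σ ≠ π₀) : ∑ j, ω (π₀ j) j < ∑ j, ω (σ j) j := by
  -- weak duality
  have hαsum : ∑ j, α (σ j) = ∑ j, α (π₀ j) := by
    rw [Equiv.sum_comp σ α, Equiv.sum_comp π₀ α]
  have hweak : ∀ j ∈ (univ : Finset (Fin r)), α (σ j) + β j ≤ (ω (σ j) j : ℤ) :=
    fun j _ => hle _ _
  have hπ0 : (∑ j, (ω (π₀ j) j : ℤ)) = ∑ j, (α (σ j) + β j) := by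
    rw [sum_add_distrib, hαsum, ← sum_add_distrib]
    exact (sum_congr rfl (fun j _ => heq j)).symm
  have hle' : (∑ j, (ω (π₀ j) j : ℤ)) ≤ ∑ j, (ω (σ j) j : ℤ) := by
    rw [hπ0]; exact sum_le_sum hweak
  rcases lt_or_eq_of_le hle' with hlt | hEq
  · exact_mod_cast hlt
  · exfalso
    -- equality: every pair of `σ` is tight, so `j ↦ π₀⁻¹ (σ j)` decreases the numbering
    rw [hπ0] at hEq
    have htight := (sum_eq_sum_iff_of_le hweak).mp hEq
    apply hσ
    have hκ : σ.trans π₀.symm = 1 := by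
      refine eq_one_of_numbering _ t (fun j hj => ?_)
      rw [Equiv.trans_apply] at hj ⊢
      refine hacyc j (π₀.symm (σ j)) hj ?_
      rw [Equiv.apply_symm_apply]
      exact htight j (mem_univ j)
    ext j
    have h1 := Equiv.ext_iff.mp hκ j
    rw [Equiv.trans_apply, Equiv.Perm.coe_one, id] at h1
    have h2 := congrArg π₀ h1
    rw [Equiv.apply_symm_apply] at h2
    rw [h2]

/-! ## 3. The inner certificate: potentials ⇒ the tropical determinant of a block -/

/-- **INNER LP-DUAL CERTIFICATE.** Potentials `φ, ψ` dominated by the block entries and tight along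
`σ₀` identify the tropical determinant `min_τ Σ_a M a (τ a)` as the cost of `σ₀`. -/
theorem inf'_eq_of_innerDuals (M : Fin h → Fin h → ℕ) (σ₀ : Equiv.Perm (Fin h)) (φ ψ : Fin h → ℤ)
    (hle : ∀ a b, φ a + ψ b ≤ (M a b : ℤ)) (heq : ∀ a, φ a + ψ (σ₀ a) = (M a (σ₀ a) : ℤ)) :
    univ.inf' univ_nonempty (fun τ : Equiv.Perm (Fin h) => ∑ a, M a (τ a)) = ∑ a, M a (σ₀ a) := by
  apply le_antisymm
  · exact inf'_le _ (mem_univ σ₀)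
  · refine le_inf' _ _ (fun τ _ => ?_)
    have h1 : (∑ a, (M a (σ₀ a) : ℤ)) ≤ ∑ a, (M a (τ a) : ℤ) := by
      calc (∑ a, (M a (σ₀ a) : ℤ)) = ∑ a, (φ a + ψ (σ₀ a)) :=
            sum_congr rfl (fun a _ => (heq a).symm)
        _ = ∑ a, φ a + ∑ a, ψ a := by rw [sum_add_distrib, Equiv.sum_comp σ₀ ψ]
        _ = ∑ a, (φ a + ψ (τ a)) := by rw [sum_add_distrib, Equiv.sum_comp τ ψ]
        _ ≤ ∑ a, (M a (τ a) : ℤ) := sum_le_sum (fun a _ => hle a (τ a))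
    exact_mod_cast h1

/-! ## 4. Assembly: a checkable certificate for UT-D / TT on one layout -/

/-- **UT-D on one layout from an LP-dual certificate.** Data: the weight `D`; for every block
`(i, j)` an inner assignment `σin i j` with potentials `φ i j, ψ i j` (dominated by the block
entries `D (ρ_{u i} a) (κ_{w j} b)`, tight along `σin i j`) and the resulting tropical determinant
`ω i j`; outer potentials `α, β` (dominated by `ω`, tight along `π₀`) and a column numbering `t`
strictly increasing along every other tight pair `(π₀ j', j)`. Conclusion: the UT-D conclusion for
`(u, w)` verbatim — `π₀` is the unique optimal outer assignment for `D`. -/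
theorem tropicalDetCertificate_of_duals {r : ℕ} (u w : Fin r → Finset (Fin h))
    (D : Fin (h + h) → Fin (h + h) → ℕ) (ω : Fin r → Fin r → ℕ)
    (σin : Fin r → Fin r → Equiv.Perm (Fin h)) (φ ψ : Fin r → Fin r → Fin h → ℤ)
    (hin_le : ∀ i j (a b : Fin h), φ i j a + ψ i j b ≤ (D (rowL (u i) a) (colL (w j) b) : ℤ))
    (hin_eq : ∀ i j (a : Fin h),
      φ i j a + ψ i j (σin i j a) = (D (rowL (u i) a) (colL (w j) (σin i j a)) : ℤ))
    (hω : ∀ i j, ω i j = ∑ a, D (rowL (u i) a) (colL (w j) (σin i j a)))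
    (π₀ : Equiv.Perm (Fin r)) (α β : Fin r → ℤ) (t : Fin r → ℕ)
    (hout_le : ∀ i j, α i + β j ≤ (ω i j : ℤ))
    (hout_eq : ∀ j, α (π₀ j) + β j = (ω (π₀ j) j : ℤ))
    (hacyc : ∀ j j', j' ≠ j → α (π₀ j') + β j = (ω (π₀ j') j : ℤ) → t j' < t j) :
    ∀ σ : Equiv.Perm (Fin r), σ ≠ π₀ →
      ∑ j, Finset.univ.inf' Finset.univ_nonempty (fun τ : Equiv.Perm (Fin h) =>
        ∑ a : Fin h, D (if a ∈ u (π₀ j) then Fin.castAdd h a else Fin.natAdd h a)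
          (if τ a ∈ w j then Fin.natAdd h (τ a) else Fin.castAdd h (τ a))) <
      ∑ j, Finset.univ.inf' Finset.univ_nonempty (fun τ : Equiv.Perm (Fin h) =>
        ∑ a : Fin h, D (if a ∈ u (σ j) then Fin.castAdd h a else Fin.natAdd h a)
          (if τ a ∈ w j then Fin.natAdd h (τ a) else Fin.castAdd h (τ a))) := by
  intro σ hσ
  have hblock : ∀ i j, univ.inf' univ_nonempty (fun τ : Equiv.Perm (Fin h) =>
      ∑ a, D (rowL (u i) a) (colL (w j) (τ a))) = ω i j := by
    intro i j
    rw [hω i j]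
    exact inf'_eq_of_innerDuals (fun a b => D (rowL (u i) a) (colL (w j) b)) (σin i j)
      (φ i j) (ψ i j) (hin_le i j) (hin_eq i j)
  show ∑ j, univ.inf' univ_nonempty (fun τ : Equiv.Perm (Fin h) =>
      ∑ a, D (rowL (u (π₀ j)) a) (colL (w j) (τ a))) <
    ∑ j, univ.inf' univ_nonempty (fun τ : Equiv.Perm (Fin h) =>
      ∑ a, D (rowL (u (σ j)) a) (colL (w j) (τ a)))
  simp only [hblock]
  exact sum_lt_sum_of_duals ω π₀ α β t hout_le hout_eq hacyc σ hσ

/-- **TT on one layout from an LP-dual certificate** (the format above composed with item 19315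
`…TropicalDet.tropicalDetCertificateSuffices`): some `H : Matrix (Fin (h+h)) (Fin (h+h)) ℂ` makes
the transversal layout matrix `(det H[ρ_{u i}, κ_{w j}])_{i,j}` nonsingular. -/
theorem transversalMinor_nonsingular_of_duals {r : ℕ} (u w : Fin r → Finset (Fin h))
    (D : Fin (h + h) → Fin (h + h) → ℕ) (ω : Fin r → Fin r → ℕ)
    (σin : Fin r → Fin r → Equiv.Perm (Fin h)) (φ ψ : Fin r → Fin r → Fin h → ℤ)
    (hin_le : ∀ i j (a b : Fin h), φ i j a + ψ i j b ≤ (D (rowL (u i) a) (colL (w j) b) : ℤ))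
    (hin_eq : ∀ i j (a : Fin h),
      φ i j a + ψ i j (σin i j a) = (D (rowL (u i) a) (colL (w j) (σin i j a)) : ℤ))
    (hω : ∀ i j, ω i j = ∑ a, D (rowL (u i) a) (colL (w j) (σin i j a)))
    (π₀ : Equiv.Perm (Fin r)) (α β : Fin r → ℤ) (t : Fin r → ℕ)
    (hout_le : ∀ i j, α i + β j ≤ (ω i j : ℤ))
    (hout_eq : ∀ j, α (π₀ j) + β j = (ω (π₀ j) j : ℤ))
    (hacyc : ∀ j j', j' ≠ j → α (π₀ j') + β j = (ω (π₀ j') j : ℤ) → t j' < t j) :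
    ∃ H : Matrix (Fin (h + h)) (Fin (h + h)) ℂ, (Matrix.of fun i j : Fin r =>
      (H.submatrix (fun a : Fin h => if a ∈ u i then Fin.castAdd h a else Fin.natAdd h a)
        (fun c : Fin h => if c ∈ w j then Fin.natAdd h c else Fin.castAdd h c)).det).det ≠ 0 :=
  TropicalDet.tropicalDetCertificateSuffices h r u w D _ (fun _ _ => rfl) π₀
    (tropicalDetCertificate_of_duals u w D ω σin φ ψ hin_le hin_eq hω π₀ α β t hout_le hout_eq
      hacyc)

end Summit.ValiantsHypothesis.ValiantsHypothesis.Theorems.BarrierLever.DualCert
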